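import Summits.ABC.IUTFork.Cor312SoundInput
import Summits.ABC.IUTFork.Cor312TeamAGapWitnessB
import HarnessLib

/-!
# [IUTchIII] Cor. 3.12 — the gap statement of record `SoundAtInput`: where its extra strength lives

Record-only file (D-0012) of the abc-iut cell (wave-5 seat abc-iut-w5-d211; independent kernel check for the
referee's QUANTIFIER-LEVEL audit of adjudication object (G1), `HOME/plan/ADJUDICATION-SPEC.md` §2 (G1′)/§4 (ii));
TAKES NO SIDE. Team A's gap statement of record `Cor312Vol.SoundAtInput P G` (abc-iut-c312-9,
`Cor312SoundInput.lean`; GAP-LEDGER G-c312-9-1) reads Step (xi-f) (kurims `paper:url-4b091feeb646` p. 184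
l. 19–29) as soundness of the multiradial algorithm at EVERY input object `o` of `†𝒞^⊩_lgp` under a value-group
gluing `G : LinkGluing P`; the typed Corollary is the instance `o := P.thetaPilot`. Kernel-checked here:

* `soundAtInput_iff_statement_of_subsingleton`: over ANY setting whose `†𝒞^⊩_lgp` has at most one object (every
  toy / gap / identified setting of record: `Ob := fun _ => Unit`), `SoundAtInput P G ↔ P.Statement` for every `G`.
* `sepSetting`: a two-object variant of Team A's gap witness over the SAME situation `GapWitness.gapSituation`
  (typed Thm. 3.11 (i)–(iii) holds, `GapWitness.gapFull_statement`): objects `Bool`, pilots `true`; the Θ-pilot's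
  Kummer images are everything (hull volume `−1`), the `q`-pilot image is `{0}` (volume `−2`) — so the typed
  Corollary HOLDS (`sepSetting_statement`), with `BridgeHyps` and `AbsLogQPos`; the second object `false` has
  Kummer images `{0}` (hull volume `−2`) and `q`-side region everything (volume `−1`).
* `not_soundAtInput_sepGluing` / `soundAtInput_pilotGluing`: in this ONE setting `SoundAtInput` FAILS for the
  gluing `G := id` and HOLDS for `G' := const (q-pilot)` (both satisfy the only typed constraint
  `link_thetaPilot`); packaged as `statement_not_imp_soundAtInput` / `soundAtInput_depends_on_gluing`.

WHAT THIS SAYS (interface level, as `GapWitness.thm311_bridgeHyps_not_imp_statement`): `SoundAtInput` is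
STRICTLY stronger than the typed Corollary over the frozen interfaces, the difference being carried entirely by
the frozen glue field `Setting.thetaRegionOf m o` at `o ≠ thetaPilot` and by `G.linkMap` off the pilot — data no
landed file constrains (in `Cor312.Setting.ofComparison`: the free binder `RealPieces.thetaBox m o` and a free
`LinkGluing`) and for which print's (xi-f), which speaks of "the input data (F⊩▶×μ-)prime-strip" (ONE input),
supplies no construction. So (G3)-type non-derivability of `SoundAtInput` is inherited from the Statement's
and localises the printed inference no further, and GapA's truth value at an instantiated setting is decided
by unpinned data unless the row also pins them (cf. the skeleton seat's note on `Sound₁`,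
`Cor312GapGlobalCountermodel.lean`). NOT said: which reading of (xi-f) is right; anything about the intended
model or about Cor. 3.12 itself; typed ≠ proved. [claim: Mochizuki2012, status: disputed]
[cite: ScholzeStix2018, §2.2 pp. 9–10]
-/


noncomputable section

namespace Summit.ABC

namespace IUTFork

namespace Cor312Vol

open Thm311 Cor312 Literature.IUT.LogThetaLattice

/-! ## 0. Over one-object settings GapA is the Corollary -/

/-- **Over a setting whose `†𝒞^⊩_lgp` has at most one object, `SoundAtInput P G ↔ P.Statement`** for every
value-group gluing `G` (the only input is the Θ-pilot, whose gluing image is the `q`-pilot by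
`G.link_thetaPilot`). All toy / gap / identified settings of record (`Ob := fun _ => Unit`) are of this kind:
there the gap statement of record IS the typed Corollary. [folklore] -/
theorem soundAtInput_iff_statement_of_subsingleton {T : ThetaIndex} {S : Situation T}
    (P : Cor312.Setting S) [Subsingleton (P.Ob P.sig.Clgp)] (G : LinkGluing P) :
    SoundAtInput P G ↔ P.Statement := by
  refine ⟨statement_of_soundAtInput P G, fun h o => ?_⟩
  have ho : o = P.thetaPilot := Subsingleton.elim _ _
  subst ho
  rw [negLogThetaAt_thetaPilot, G.link_thetaPilot, negLogQAt_qPilot]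
  exact h

namespace SoundSeparation

open Cor312.Checks GapWitness

/-! ## 1. A two-object output of Prop. 3.7 and the separating setting -/

/-- A two-object output of [IUTchIII] Prop. 3.7 over points: every Frobenioid has object type `Bool`, the
object-forming algorithms return `true` (so both pilots are `true`), the embeddings are the diagonal.
[folklore] -/
def twoSig : GlobalLGPFrobenioidSignature 2 Unit (· ∈ (Set.univ : Set Unit)) Unit (fun _ _ => Unit)
    (fun _ => Bool) id Unit (fun _ _ => Unit) (fun _ _ => Unit) where
  FMOD := fun _ => ()
  Fmod := fun _ => ()
  Ffrak := fun _ => ()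
  isoModMOD := fun _ => ()
  isoModFrak := fun _ => ()
  isoFrakMOD := fun _ => ()
  CLGP := ()
  Clgp := ()
  FLGP := ()
  Flgp := ()
  Fgau := ()
  isoGauLGP := ()
  isoLGPlgp := ()
  isoCLGPlgp := ()
  embLGP := fun b _ => b
  embLgp := fun b _ => b
  embLGP_injective := fun _ _ h => congrFun h 0
  embLgp_injective := fun _ _ h => congrFun h 0
  objOfLgp := fun _ => true
  objOfLGP := fun _ => true
  objOfFrak := fun _ _ => true
  objOfMOD := fun _ _ => true

/-- **The separating setting** over Team A's `GapWitness.gapSituation` (log-volume `−2` on subsets of `{0}`,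
`−1` elsewhere; hull frame `{{0}, univ}`): objects `Bool`, pilots `true`; Kummer images of the object `true`
(the Θ-pilot) = everything, of the object `false` = `{0}`; `q`-side region of `true` (the `q`-pilot) = `{0}`,
of `false` = everything. The glue fields are exactly the data the frozen interfaces leave free. [folklore] -/
def sepSetting : Setting gapSituation where
  n := 0
  HT := ℤ × ℤ
  LogLink := fun _ _ => Unit
  IsFull := fun _ => True
  lattice :=
    { theater := fun n m => (n, m)
      distinct := fun p q h => by simpa using h
      logLink := fun _ _ => ()
      logLink_full := fun _ _ => trivial }
  Frd := Unit
  IsoF := fun _ _ => Unit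
  Ob := fun _ => Bool
  realify := id
  Strip := Unit
  IsoS := fun _ _ => Unit
  M := fun _ _ => Unit
  sig := twoSig
  split := { Msplit := fun _ _ => ⊤, exists_gen := fun _ _ => ⟨⟨(), trivial⟩, top_unit_isGenerator _⟩ }
  ObΔ := Bool
  N := fun _ _ => Unit
  qData := { q := fun _ _ => (), q_gen := fun _ _ => unit_isGenerator _, objOf := fun _ => true }
  frame := fun j vQ => gapFrame _
  hul_adm := fun _ _ _ _ => trivial
  thetaRegionOf := fun _ o _ _ => cond o Set.univ {0}
  qRegionOf := fun o' _ _ => cond o' {0} Set.univ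
  qRegion_mem := fun _ _ => Set.mem_insert _ _
  qSupport_finite := fun _ => Set.toFinite _

/-- Both pilot objects of the separating setting are `true`. [folklore] -/
theorem pilots_eq : sepSetting.thetaPilot = true ∧ sepSetting.qPilot = true := ⟨rfl, rfl⟩

/-- The gluing `G := id` on objects (`true ↦ true = q`-pilot, so (xi-a)'s `link_thetaPilot` holds; the
non-pilot input `false` is glued to the non-pilot `q`-side object `false`). [folklore] -/
def sepGluing : LinkGluing sepSetting where
  linkMap := fun o => o
  link_thetaPilot := rfl

/-- The gluing `G' :=` "every input ↦ the `q`-pilot" (also satisfies `link_thetaPilot`). [folklore] -/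
def pilotGluing : LinkGluing sepSetting where
  linkMap := fun _ => true
  link_thetaPilot := rfl

/-! ## 2. The pilot quantities: `−|log(Θ)| = −1`, `−|log(q)| = −2` (the Corollary HOLDS) -/

/-- The (Ind3)-enlarged Θ-pilot region is everything. [folklore] -/
theorem sep_thetaRegion3 (j : toyIndex.Label) (vQ : toyIndex.VQ) :
    sepSetting.thetaRegion3 j vQ = Set.univ := by
  show (⋃ _ : ℤ, (Set.univ : Set (toyShells.Packet j vQ))) = Set.univ
  exact Set.iUnion_const _

/-- The possible images of the Θ-pilot are exactly `univ` (indeterminacies are bijections). [folklore] -/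
theorem sep_mem_possibleImages_iff (j : toyIndex.Label) (vQ : toyIndex.VQ)
    (U : Set (toyShells.Packet j vQ)) :
    U ∈ sepSetting.possibleImages j vQ ↔ U = Set.univ := by
  constructor
  · rintro ⟨Φ, -, rfl⟩
    rw [sep_thetaRegion3, Set.image_univ]
    exact Set.range_eq_univ.mpr (Φ j vQ).surjective
  · rintro rfl
    exact sep_thetaRegion3 j vQ ▸ sepSetting.thetaRegion3_mem_possibleImages j vQ

/-- The union of the possible images of the Θ-pilot is everything. [folklore] -/
theorem sep_sUnion_possibleImages (j : toyIndex.Label) (vQ : toyIndex.VQ) :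
    ⋃₀ sepSetting.possibleImages j vQ = (Set.univ : Set (toyShells.Packet j vQ)) :=
  Set.eq_univ_of_univ_subset
    (Set.subset_sUnion_of_mem ((sep_mem_possibleImages_iff j vQ _).2 rfl))

/-- The packet hull of the Θ-pilot is everything. [folklore] -/
theorem sep_thetaHull (j : toyIndex.Label) (vQ : toyIndex.VQ) :
    sepSetting.thetaHull j vQ = (Set.univ : Set (toyShells.Packet j vQ)) := by
  apply Set.eq_univ_of_univ_subset
  show Set.univ ⊆ (gapFrame _).hull (⋃₀ sepSetting.possibleImages j vQ)
  exact (sep_sUnion_possibleImages j vQ).symm.le.trans ((gapFrame _).subset_hull _)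

/-- Every union of possible images admits its hull (the gap frame bounds everything). [folklore] -/
theorem sep_hullDefined (j : toyIndex.Label) (vQ : toyIndex.VQ) : sepSetting.HullDefined j vQ :=
  ⟨trivial, trivial⟩

/-- The local Θ-volume is `−1` in every packet. [folklore] -/
theorem sep_thetaLocal (j : toyIndex.Label) (vQ : toyIndex.VQ) :
    sepSetting.thetaLocal j vQ = ((-1 : ℝ) : WithTop ℝ) := by
  unfold Setting.thetaLocal
  rw [if_pos (sep_hullDefined j vQ)]
  show ((gapData.logvol j vQ (sepSetting.thetaHull j vQ) : ℝ) : WithTop ℝ) = _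
  rw [sep_thetaHull, gapData_logvol_univ]

/-- The local `q`-volume is `−2` in every packet (the `q`-pilot image is `{0}`). [folklore] -/
theorem sep_qLocal (j : toyIndex.Label) (vQ : toyIndex.VQ) : sepSetting.qLocal j vQ = -2 := by
  show gapData.logvol j vQ ({0} : Set (toyShells.Packet j vQ)) = -2
  exact gapData_logvol_of_subset subset_rfl

/-- The separating setting is `ThetaFinite`. [folklore] -/
theorem sep_thetaFinite : sepSetting.ThetaFinite :=
  ⟨fun i vQ => by rw [sep_thetaLocal]; exact WithTop.coe_ne_top, fun _ => Set.toFinite _⟩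

/-- `−|log(Θ)| = −1`. [folklore] -/
theorem sep_negLogTheta : sepSetting.negLogTheta = ((-1 : ℝ) : WithTop ℝ) := by
  unfold Setting.negLogTheta
  rw [if_pos sep_thetaFinite]
  have h : ∀ i : Fin toyIndex.lstar,
      (∑ᶠ vQ : toyIndex.VQ, (sepSetting.thetaLocal (Setting.labelSucc i) vQ).untopD 0) = -1 := fun i => by
    rw [show (fun vQ : toyIndex.VQ => (sepSetting.thetaLocal (Setting.labelSucc i) vQ).untopD 0) =
        fun _ => (-1 : ℝ) from funext fun vQ => by rw [sep_thetaLocal, WithTop.untopD_coe], finsum_unique]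
  simp only [h]
  exact congrArg _ (processionNormalized_const (by decide) (-1))

/-- `−|log(q)| = −2`. [folklore] -/
theorem sep_negLogQ : sepSetting.negLogQ = -2 := by
  unfold Setting.negLogQ
  have h : ∀ i : Fin toyIndex.lstar,
      (∑ᶠ vQ : toyIndex.VQ, sepSetting.qLocal (Setting.labelSucc i) vQ) = -2 := fun i => by
    rw [show (fun vQ : toyIndex.VQ => sepSetting.qLocal (Setting.labelSucc i) vQ) = fun _ => (-2 : ℝ) from
        funext fun vQ => sep_qLocal _ vQ, finsum_unique]
  simp only [h]
  exact processionNormalized_const (by decide) (-2)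

/-- **The typed Corollary 3.12 HOLDS in the separating setting** (`−2 ≤ −1`). [folklore] -/
theorem sepSetting_statement : sepSetting.Statement := by
  refine ⟨?_, ?_⟩
  · rw [sep_negLogTheta]; exact WithTop.coe_ne_top
  · rw [sep_negLogQ, sep_negLogTheta, WithTop.coe_le_coe]; norm_num

/-- "`|log(q)| > 0`" holds (`−|log(q)| = −2 < 0`). [folklore] -/
theorem sepSetting_absLogQPos : sepSetting.AbsLogQPos := by
  show sepSetting.negLogQ < 0
  rw [sep_negLogQ]; norm_num

/-- All bridge hypotheses of `Cor312StatementBridge` hold in the separating setting. [folklore] -/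
theorem sepSetting_bridgeHyps : BridgeHyps sepSetting where
  mono := fun i vQ A B _ _ hAB => gapData_logvol_mono hAB
  image_adm := fun _ _ _ _ => trivial
  image_fin := fun _ => Set.toFinite _
  hul_nonempty := fun j vQ H hH => by
    rcases hH with rfl | rfl
    · exact ⟨0, rfl⟩
    · exact ⟨0, Set.mem_univ 0⟩
  theta_nonempty := fun i vQ => by
    rw [sep_thetaRegion3]
    exact ⟨0, Set.mem_univ 0⟩
  finite := sep_thetaFinite

/-! ## 3. The non-pilot input `false`: hull volume `−2`, `q`-side volume `−1` -/

/-- The (Ind3)-enlarged Kummer image of the non-pilot object is `{0}`. [folklore] -/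
theorem sep_thetaRegion3At_false (j : toyIndex.Label) (vQ : toyIndex.VQ) :
    thetaRegion3At sepSetting false j vQ = {0} := by
  show (⋃ _ : ℤ, ({0} : Set (toyShells.Packet j vQ))) = {0}
  exact Set.iUnion_const _

/-- Its possible images are exactly `{0}` (indeterminacies are `ℚ`-linear). [folklore] -/
theorem sep_mem_possibleImagesAt_false_iff (j : toyIndex.Label) (vQ : toyIndex.VQ)
    (U : Set (toyShells.Packet j vQ)) :
    U ∈ possibleImagesAt sepSetting false j vQ ↔ U = {0} := by
  constructor
  · rintro ⟨Φ, -, rfl⟩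
    rw [sep_thetaRegion3At_false, Set.image_singleton, map_zero]
    rfl
  · rintro rfl
    refine ⟨1, (Setting.indGroup gapSituation).one_mem, ?_⟩
    rw [sep_thetaRegion3At_false, Set.image_singleton, map_zero]
    rfl

/-- The union of its possible images is `{0}`. [folklore] -/
theorem sep_sUnion_possibleImagesAt_false (j : toyIndex.Label) (vQ : toyIndex.VQ) :
    ⋃₀ possibleImagesAt sepSetting false j vQ = ({0} : Set (toyShells.Packet j vQ)) := by
  ext x
  simp only [Set.mem_sUnion]
  constructor
  · rintro ⟨U, hU, hx⟩
    rwa [(sep_mem_possibleImagesAt_false_iff j vQ U).1 hU] at hx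
  · intro hx
    exact ⟨{0}, (sep_mem_possibleImagesAt_false_iff j vQ _).2 rfl, hx⟩

/-- Its packet hull lies in `{0}`. [folklore] -/
theorem sep_thetaHullAt_false_subset (j : toyIndex.Label) (vQ : toyIndex.VQ) :
    thetaHullAt sepSetting false j vQ ⊆ {0} := by
  show (gapFrame _).hull (⋃₀ possibleImagesAt sepSetting false j vQ) ⊆ {0}
  exact gapFrame_hull_of_subset (sep_sUnion_possibleImagesAt_false j vQ).le

/-- Its unions of possible images admit hulls. [folklore] -/
theorem sep_hullDefinedAt_false (j : toyIndex.Label) (vQ : toyIndex.VQ) :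
    HullDefinedAt sepSetting false j vQ :=
  ⟨trivial, trivial⟩

/-- Its local hull volume is `−2` in every packet. [folklore] -/
theorem sep_thetaLocalAt_false (j : toyIndex.Label) (vQ : toyIndex.VQ) :
    thetaLocalAt sepSetting false j vQ = ((-2 : ℝ) : WithTop ℝ) := by
  unfold thetaLocalAt
  rw [if_pos (sep_hullDefinedAt_false j vQ)]
  show ((gapData.logvol j vQ (thetaHullAt sepSetting false j vQ) : ℝ) : WithTop ℝ) = _
  rw [gapData_logvol_of_subset (sep_thetaHullAt_false_subset j vQ)]

/-- "`−|log(Θ)|` of the input `false` is finite". [folklore] -/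
theorem sep_thetaFiniteAt_false : ThetaFiniteAt sepSetting false :=
  ⟨fun i vQ => by rw [sep_thetaLocalAt_false]; exact WithTop.coe_ne_top, fun _ => Set.toFinite _⟩

/-- The global hull volume of the input `false` is `−2`. [folklore] -/
theorem sep_negLogThetaAt_false : negLogThetaAt sepSetting false = ((-2 : ℝ) : WithTop ℝ) := by
  unfold negLogThetaAt
  rw [if_pos sep_thetaFiniteAt_false]
  have h : ∀ i : Fin toyIndex.lstar, (∑ᶠ vQ : toyIndex.VQ,
      (thetaLocalAt sepSetting false (Setting.labelSucc i) vQ).untopD 0) = -2 := fun i => by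
    rw [show (fun vQ : toyIndex.VQ => (thetaLocalAt sepSetting false (Setting.labelSucc i) vQ).untopD 0) =
        fun _ => (-2 : ℝ) from funext fun vQ => by rw [sep_thetaLocalAt_false, WithTop.untopD_coe],
      finsum_unique]
  simp only [h]
  exact congrArg _ (processionNormalized_const (by decide) (-2))

/-- The local `q`-side volume of the non-pilot `q`-object `false` is `−1` (its region is everything).
[folklore] -/
theorem sep_qLocalAt_false (j : toyIndex.Label) (vQ : toyIndex.VQ) :
    qLocalAt sepSetting false j vQ = -1 := by
  show gapData.logvol j vQ (Set.univ : Set (toyShells.Packet j vQ)) = -1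
  exact gapData_logvol_univ j vQ

/-- The global `q`-side volume of the non-pilot `q`-object `false` is `−1`. [folklore] -/
theorem sep_negLogQAt_false : negLogQAt sepSetting false = -1 := by
  unfold negLogQAt
  have h : ∀ i : Fin toyIndex.lstar,
      (∑ᶠ vQ : toyIndex.VQ, qLocalAt sepSetting false (Setting.labelSucc i) vQ) = -1 := fun i => by
    rw [show (fun vQ : toyIndex.VQ => qLocalAt sepSetting false (Setting.labelSucc i) vQ) = fun _ => (-1 : ℝ)
        from funext fun vQ => sep_qLocalAt_false _ vQ, finsum_unique]
  simp only [h]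
  exact processionNormalized_const (by decide) (-1)

/-- The global hull volume of the pilot input `true` is `−|log(Θ)| = −1`. [folklore] -/
theorem sep_negLogThetaAt_true : negLogThetaAt sepSetting true = ((-1 : ℝ) : WithTop ℝ) :=
  (negLogThetaAt_thetaPilot sepSetting).trans sep_negLogTheta

/-- The global `q`-side volume of the `q`-pilot `true` is `−|log(q)| = −2`. [folklore] -/
theorem sep_negLogQAt_true : negLogQAt sepSetting true = -2 :=
  (negLogQAt_qPilot sepSetting).trans sep_negLogQ

/-! ## 4. The separation -/

/-- **`SoundAtInput` FAILS in the separating setting for the gluing `G := id`**: the non-pilot input `false`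
has `q`-side volume `−1 > −2 =` its hull volume — although the typed Corollary 3.12 holds there. [folklore] -/
theorem not_soundAtInput_sepGluing : ¬ SoundAtInput sepSetting sepGluing := by
  intro h
  obtain ⟨-, hle⟩ := h false
  change ((negLogQAt sepSetting false : ℝ) : WithTop ℝ) ≤ negLogThetaAt sepSetting false at hle
  rw [sep_negLogQAt_false, sep_negLogThetaAt_false, WithTop.coe_le_coe] at hle
  norm_num at hle

/-- **`SoundAtInput` HOLDS in the SAME setting for the gluing `G' :=` "everything ↦ the `q`-pilot"**
(every input's `q`-side volume is then `−2`, below both hull volumes `−1`, `−2`). [folklore] -/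
theorem soundAtInput_pilotGluing : SoundAtInput sepSetting pilotGluing := by
  intro o
  change negLogThetaAt sepSetting o ≠ ⊤ ∧
    ((negLogQAt sepSetting true : ℝ) : WithTop ℝ) ≤ negLogThetaAt sepSetting o
  rw [sep_negLogQAt_true]
  cases o with
  | false =>
    rw [sep_negLogThetaAt_false]
    exact ⟨WithTop.coe_ne_top, le_rfl⟩
  | true =>
    rw [sep_negLogThetaAt_true, WithTop.coe_le_coe]
    exact ⟨WithTop.coe_ne_top, by norm_num⟩

/-- **SEPARATION (∃-form, the shape of `GapWitness.thm311_bridgeHyps_not_imp_statement`).** There is an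
instantiation in which the typed Theorem 3.11 (i) ∧ (ii) ∧ (iii) holds in full, every bridge hypothesis
holds, `|log(q)| > 0`, the typed Corollary 3.12 HOLDS — and the gap statement of record `SoundAtInput` FAILS
(at a non-pilot input). So over the frozen interfaces `SoundAtInput` is STRICTLY stronger than the
Corollary, the difference being a condition on the free glue data at non-pilot objects. [folklore] -/
theorem statement_not_imp_soundAtInput :
    ∃ (T : ThetaIndex) (F : FullSituation T) (P : Setting F.toLatticeSituation.toSituation)
      (G : LinkGluing P),
      F.Statement ∧ BridgeHyps P ∧ P.AbsLogQPos ∧ P.Statement ∧ ¬ SoundAtInput P G :=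
  ⟨toyIndex, gapFull, sepSetting, sepGluing, gapFull_statement, sepSetting_bridgeHyps,
    sepSetting_absLogQPos, sepSetting_statement, not_soundAtInput_sepGluing⟩

/-- **GapA's truth value depends on the gluing off the pilot.** In ONE setting (typed Thm. 3.11, bridge
hypotheses, `|log(q)| > 0` and the typed Corollary all holding) there are two value-group gluings, both
satisfying (xi-a)'s `link_thetaPilot`, one validating and one violating `SoundAtInput`. [folklore] -/
theorem soundAtInput_depends_on_gluing :
    ∃ (T : ThetaIndex) (F : FullSituation T) (P : Setting F.toLatticeSituation.toSituation)
      (G G' : LinkGluing P),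
      F.Statement ∧ BridgeHyps P ∧ P.AbsLogQPos ∧ P.Statement ∧ SoundAtInput P G' ∧ ¬ SoundAtInput P G :=
  ⟨toyIndex, gapFull, sepSetting, sepGluing, pilotGluing, gapFull_statement, sepSetting_bridgeHyps,
    sepSetting_absLogQPos, sepSetting_statement, soundAtInput_pilotGluing, not_soundAtInput_sepGluing⟩

/-- For contrast, in Team A's ONE-object gap witness the gap statement of record is literally the (false)
typed Corollary, for every gluing (`soundAtInput_iff_statement_of_subsingleton`). [folklore] -/
theorem not_soundAtInput_gapSetting (G : LinkGluing gapSetting) : ¬ SoundAtInput gapSetting G :=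
  haveI : Subsingleton (gapSetting.Ob gapSetting.sig.Clgp) := inferInstanceAs (Subsingleton Unit)
  fun h => gapSetting_not_statement ((soundAtInput_iff_statement_of_subsingleton gapSetting G).1 h)

end SoundSeparation

end Cor312Vol

end IUTFork

end Summit.ABC

end
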